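import Summits.AnomalousDissipation.AnomalousDissipation.Theorems.SolenoidalFractalHomogenisationLagrangianStepVmodFfIterate
import Summits.AnomalousDissipation.AnomalousDissipation.Theorems.SolenoidalFractalHomogenisationLagrangianStepVmodSfCoarseMid
import HarnessLib

/-!
# K1L_D (stmt-AnomalousDissipation-27980): (V_mod) flat stage, block (ff) at grid phase — COARSE LABELS, part 2: the LONG-WINDOW row (`Rτ ≥ 2`)
# for a FAST class datum, in the allowance currency (prover ad-k3l-bookkeeping-p1 g10; RULING D28-9/D28-17 (a) assign the (ff) grid twin to k3l;
# helper `--supports 27980 --as helper`)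

The fast-datum twin of `…VmodSfCoarseLong.sideband_le_alw_of_scale_iter`: SAME grid (`s = j₀P`, `t₁ = ⌈1/u⌉·P`, `u = RP ≤ 1`, `Rτ ≥ 2`,
`j = ⌊τ/t₁⌋ ≥ 1`), SAME smallness hypothesis `e^{−1/2} + cV + cL^* + 3cS + κ^* ≤ 3/4` VERBATIM, the window factor `(j+1)²ρ^{j−1} ≤ 265`; the
sideband of `…VmodFfIterate.sideband_le_iterate_fast` (`≤ (2(cS+κ)^j + 21·cS·ρ^j)·‖v‖` for a fast class datum `v`: `𝓕v ⊆ ±ℓ + nℤ³`,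
`𝓕v(±ℓ) = 0`) is charged to the cap: `ρ^j ≤ ρ^{j−1} ≤ 265(m₁y)²`, `(cS+κ)^j ≤ (cS+κ)ρ^{j−1}`, `cS ≤ cSp√u` (`cS_le_cSp_sqrt`),
`m₁y ≤ 2y/u`, `√u(2y/u)² ≤ √2·√y ≤ √2·y^e` (`2y ≤ u`, `e ≤ 1/2`), and the kill `κ ≤ exp(−a₁/u) ≤ 2u²/a₁²` (`a₁ := π²(lo/Λ)M·Wp/2`,
`Real.quadratic_le_exp_of_nonneg`) so `κ(2y/u)² ≤ 8y²/a₁² ≤ 8y^e/a₁²`: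

  `sideband(U s t v) ≤ (C₁(C₁(ν^e + (⌈K/ν⌉/n)^e) + (min 1 (P/τ))^e)) · ‖v‖`   (`sideband_le_alw_of_scale_iter_fast`)

for `C₁ ≥ 8750·cSp + 4240/a₁²` — no (V)-constant in the threshold.  `sorry`-free; NOT a proof of (ff), of the stub, of K1L_D or of AD; rung F-D1.A0.
-/

set_option linter.dupNamespace false

noncomputable section

namespace Summit.AnomalousDissipation.AnomalousDissipation.Theorems.SolenoidalFractalHomogenisation.LagrangianStep.VmodGen

open Set MeasureTheory Complex UnitAddTorus
open scoped InnerProductSpace ENNReal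
open Literature.Analysis Literature.Analysis.FunctionSpaces Literature.Analysis.FunctionSpaces.Torus
open Literature.Analysis.FluidPDE Literature.Analysis.FluidPDE.Torus Literature.Analysis.FluidPDE.LatticeShear
open Summit.AnomalousDissipation.AnomalousDissipation.Theorems.SolenoidalFractalHomogenisation.LagrangianStep.Sideband (slotAmp)
open Summit.AnomalousDissipation.AnomalousDissipation.Theorems.SolenoidalFractalHomogenisation.LagrangianStep.VmodFlat (fc fc_sub loT dW)

section Clause

variable {k : ℕ} {W : LatticeWord k} {M : ℝ} {hM : 0 < M} {c : ℝ}
  {Φ : ℝ → Visc4 (Fin 3) → Visc4 (Fin 3)} {lo hi Λ β σ C ν₀ K : ℝ}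
  {ν : ℝ} {n : ℕ} {𝔸 : Visc4 (Fin 3)} {Tw : ℝ} {U T : ℝ → ℝ → (V2 →L[ℝ] V2)}

set_option maxHeartbeats 8000000 in
/-- **THE LONG-WINDOW ROW OF (ff) ON COARSE LABELS, FAST CLASS DATUM** (grid phase).  See the module docstring. -/
theorem sideband_le_alw_of_scale_iter_fast (hV : SlowVectorClauseF W M hM c Φ lo hi Λ β σ C ν₀ K)
    (hlo : 0 < lo) (hhi : 0 ≤ hi) (hΛ : 1 ≤ Λ) (hc : 0 < c) (hC : 0 ≤ C) (hK : 0 ≤ K)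
    (hν : ν ∈ Set.Ioo 0 ν₀) (hn : 1 ≤ n) (hodd : OddSmall 𝔸 (ν * β))
    (hwin : ∃ lam ∈ Set.Icc (1:ℝ) Λ, NearIso 𝔸 (ν * (lo / lam)) (ν * (hi * lam)))
    (hΦw : ∃ lam ∈ Set.Icc (1:ℝ) Λ, NearIso (Φ ν ((1 / ν) • 𝔸)) (lo / lam) (hi * lam))
    (hU : IsPropagator Tw (cellField W M hM ν hν.1 n) ((1 / (n:ℝ) ^ 2) • 𝔸) U)
    (hT : IsPropagator Tw (fun (_ : ℝ) (_ : UnitAddTorus (Fin 3)) => (0 : EuclideanSpace ℝ (Fin 3)))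
      ((1 / (n:ℝ) ^ 2) • (𝔸 + (c / ν) • Φ ν ((1 / ν) • 𝔸))) T)
    {s t : ℝ} (j₀ : ℕ) (hs₀ : s = j₀ * (M * W.period / ν)) (hst : s < t) (htT : t ≤ Tw)
    {Lb : ℕ} (hLb : 2 * Lb < n) {ℓ : Fin 3 → ℤ} (hℓ0 : ℓ ≠ 0) (hℓL : ℓ ∈ Torus.freqBall (d := Fin 3) Lb)
    (hscale : ‖Torus.latticeVec ℓ‖ * (⌈K / ν⌉₊ : ℝ) ≤ n)
    (v : V2) (hv : v ∈ divFreeL2 (Fin 3))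
    (hvcl : ∀ k', fc v k' ≠ 0 → (∀ i, (n : ℤ) ∣ k' i - ℓ i) ∨ (∀ i, (n : ℤ) ∣ k' i + ℓ i)) (hv1 : fc v ℓ = 0) (hv2 : fc v (-ℓ) = 0)
    {C₁ e : ℝ} (hC₁0 : 0 ≤ C₁)
    (hC₁s : 8750 * (8 * (∑ j, ‖slotAmp W j‖) / (Real.pi * (lo / Λ) * Real.sqrt (8 * Real.pi ^ 2 * (lo / Λ) * (M * W.period) * c)))
      + 4240 / (Real.pi ^ 2 * (lo / Λ) * (M * W.period) / 2) ^ 2 ≤ C₁)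
    (he12 : e ≤ 1 / 2)
    (hρ : Real.exp (-(1 / 2 : ℝ))
        + 2 * Real.sqrt 2 * (C * (C * (ν ^ σ + (‖Torus.latticeVec ℓ‖ * (⌈K / ν⌉₊ : ℝ) / n) ^ σ)
            + (8 * Real.pi ^ 2 * ‖Torus.latticeVec ℓ‖ ^ 2 * (hi * Λ) * (ν + c / ν) / (n:ℝ) ^ 2) * (M * W.period / ν)))
        + (12 * k * (Real.sqrt (freqNormSq ℓ) / n) / (Real.pi ^ 2 * (ν * (lo / Λ))))
            * Real.exp (9 * (k : ℝ) ^ 2 / (2 * Real.pi ^ 4 * (lo / Λ) ^ 2 * c))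
        + 3 * (8 * (Real.sqrt (freqNormSq ℓ) / n) * (∑ j, ‖slotAmp W j‖) / (Real.pi * (ν * (lo / Λ))))
        + Real.exp (-(Real.pi ^ 2 * (ν * (lo / Λ)) / 2 * (1 / (8 * Real.pi ^ 2 * loT lo Λ c ν n * Torus.freqNormSq ℓ))))
        ≤ 3 / 4)
    (hRP : 8 * Real.pi ^ 2 * loT lo Λ c ν n * Torus.freqNormSq ℓ * (M * W.period / ν) ≤ 1)
    (hRτ : 2 ≤ 8 * Real.pi ^ 2 * loT lo Λ c ν n * Torus.freqNormSq ℓ * (t - s)) :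
    Real.sqrt (‖U s t v‖ ^ 2 - (‖fc (U s t v) ℓ‖ ^ 2 + ‖fc (U s t v) (-ℓ)‖ ^ 2))
      ≤ (C₁ * (C₁ * (ν ^ e + ((⌈K / ν⌉₊ : ℝ) / n) ^ e) + (min 1 ((M * W.period / ν) / (t - s))) ^ e)) * ‖v‖ := by
  classical
  -- ### scalars
  have hτ0 : 0 < t - s := by linarith
  have hsT : s < Tw := lt_of_lt_of_le hst htT
  have hn0 : (0:ℝ) < n := by exact_mod_cast (show 0 < n from hn)
  have hΛ0 : 0 < Λ := lt_of_lt_of_le one_pos hΛ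
  have hloΛ : 0 < lo / Λ := div_pos hlo hΛ0
  have hloA : 0 < ν * (lo / Λ) := mul_pos hν.1 hloΛ
  have hWp := PermissibleCarrier.period_pos W
  have hMW : 0 < M * W.period := mul_pos hM hWp
  have hL0 : 0 < ‖Torus.latticeVec ℓ‖ := by
    refine norm_pos_iff.2 fun h => hℓ0 ?_
    funext i
    have hi := congrArg (fun w : EuclideanSpace ℝ (Fin 3) => w i) h
    simpa [Torus.latticeVec_apply] using hi
  set q : ℝ := Torus.freqNormSq ℓ with hq
  have hq0 : 0 < q := by rw [hq, ← norm_latticeVec_sq_eq]; positivity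
  have hνne : ν ≠ 0 := hν.1.ne'
  have hτne : t - s ≠ 0 := hτ0.ne'
  set P : ℝ := M * W.period / ν with hP
  have hP0 : 0 < P := div_pos hMW hν.1
  have hPne : P ≠ 0 := hP0.ne'
  set R : ℝ := 8 * Real.pi ^ 2 * loT lo Λ c ν n * q with hR
  have hR0 : 0 < R := by
    by_contra h; push Not at h
    have := mul_nonpos_of_nonpos_of_nonneg h hτ0.le
    linarith
  have hRne : R ≠ 0 := hR0.ne'
  set u : ℝ := R * P with hu
  have hu0 : 0 < u := mul_pos hR0 hP0
  have hune : u ≠ 0 := hu0.ne'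
  have hu1 : u ≤ 1 := hRP
  set m₁ : ℕ := ⌈1 / u⌉₊ with hm₁
  have hm₁pos : 0 < m₁ := Nat.ceil_pos.2 (by positivity)
  have hm₁1 : 1 ≤ m₁ := hm₁pos
  have hm₁r : (0:ℝ) < m₁ := by exact_mod_cast hm₁pos
  have hm₁u : 1 / u ≤ (m₁ : ℝ) := Nat.le_ceil _
  have hm₁2 : (m₁ : ℝ) ≤ 2 / u := by
    have h1 := (Nat.ceil_lt_add_one (by positivity : (0:ℝ) ≤ 1 / u)).le
    have h2 : (1:ℝ) ≤ 1 / u := by rw [le_div_iff₀ hu0]; linarith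
    calc (m₁ : ℝ) ≤ 1 / u + 1 := h1
      _ ≤ 2 / u := by rw [div_add_one hu0.ne', div_le_div_iff_of_pos_right hu0]; linarith
  set t₁ : ℝ := m₁ * P with ht₁
  have ht₁0 : 0 < t₁ := mul_pos hm₁r hP0
  have hRt₁ : 1 ≤ R * t₁ := by
    have := mul_le_mul_of_nonneg_left hm₁u hu0.le
    calc (1:ℝ) = u * (1 / u) := by field_simp
      _ ≤ u * m₁ := this
      _ = R * t₁ := by rw [ht₁, hu]; ring
  have ht₁lo : 1 / R ≤ t₁ := by rw [div_le_iff₀ hR0]; linarith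
  have ht₁hi : t₁ ≤ 2 / R := by
    have := mul_le_mul_of_nonneg_right hm₁2 hP0.le
    calc t₁ = m₁ * P := ht₁
      _ ≤ 2 / u * P := this
      _ = 2 / R := by rw [hu]; field_simp
  have ht₁τ : t₁ ≤ t - s := ht₁hi.trans (by rw [div_le_iff₀ hR0]; linarith)
  -- ### the one-step constants and their envelopes
  set g : ℝ := ‖Torus.latticeVec ℓ‖ * (⌈K / ν⌉₊ : ℝ) / n with hg
  set ξ : ℝ := 8 * Real.pi ^ 2 * ‖Torus.latticeVec ℓ‖ ^ 2 * (hi * Λ) * (ν + c / ν) / (n:ℝ) ^ 2 with hξ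
  set r₀ : ℝ := hi * Λ ^ 2 / lo with hr₀
  set κ₀ : ℝ := (K + 1) ^ 2 / (8 * Real.pi ^ 2 * (lo / Λ) * (M * W.period) * c) with hκ₀
  set D₀ : ℝ := 8 * Real.pi ^ 2 * (lo / Λ) * (M * W.period) * c with hD₀
  set E₁ : ℝ := 9 * (k : ℝ) ^ 2 / (2 * Real.pi ^ 4 * (lo / Λ) ^ 2 * c) with hE₁
  have hg0 : 0 ≤ g := by rw [hg]; positivity
  have hr₀0 : 0 ≤ r₀ := by rw [hr₀]; positivity
  have hκ₀0 : 0 ≤ κ₀ := by rw [hκ₀]; positivity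
  have hD₀0 : 0 < D₀ := by rw [hD₀]; positivity
  have hξR : ξ = r₀ * R := by rw [hξ, hr₀, hR, hq, norm_latticeVec_sq_eq]; unfold loT; field_simp
  set θ : ℝ := Real.exp (-(4 * Real.pi ^ 2 * loT lo Λ c ν n * q * (m₁ * P))) with hθ
  set cV : ℝ := 2 * Real.sqrt 2 * (C * (C * (ν ^ σ + g ^ σ) + ξ * P)) with hcV
  set cL : ℝ := (12 * k * (Real.sqrt q / n) / (Real.pi ^ 2 * (ν * (lo / Λ)))) *
      Real.exp (18 * (k : ℝ) ^ 2 * (q / (n : ℝ) ^ 2) * (m₁ * P) / (Real.pi ^ 2 * (ν * (lo / Λ)))) with hcL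
  set cLs : ℝ := (12 * k * (Real.sqrt q / n) / (Real.pi ^ 2 * (ν * (lo / Λ)))) * Real.exp E₁ with hcLs
  set cS : ℝ := 8 * (Real.sqrt q / n) * (∑ j, ‖slotAmp W j‖) / (Real.pi * (ν * (lo / Λ))) with hcS
  set κ : ℝ := Real.exp (-(Real.pi ^ 2 * (ν * (lo / Λ)) / 2 * (m₁ * P))) with hκ
  set κs : ℝ := Real.exp (-(Real.pi ^ 2 * (ν * (lo / Λ)) / 2 * (1 / R))) with hκs
  have hθ0 : 0 ≤ θ := (Real.exp_pos _).le
  have hξ0 : 0 ≤ ξ := by rw [hξR]; exact mul_nonneg hr₀0 hR0.le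
  have hcV0 : 0 ≤ cV := by
    rw [hcV]
    exact mul_nonneg (by positivity) (mul_nonneg hC (add_nonneg (mul_nonneg hC (add_nonneg (Real.rpow_nonneg hν.1.le σ)
      (Real.rpow_nonneg hg0 σ))) (mul_nonneg hξ0 hP0.le)))
  have hcL0 : 0 ≤ cL := by rw [hcL]; positivity
  have hcS0 : 0 ≤ cS := by rw [hcS]; positivity
  have hκ0' : 0 ≤ κ := (Real.exp_pos _).le
  -- `θ ≤ e^{-1/2}`
  have hθs : θ ≤ Real.exp (-(1 / 2 : ℝ)) := by
    rw [hθ]; refine Real.exp_le_exp.2 ?_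
    have : 4 * Real.pi ^ 2 * loT lo Λ c ν n * q * (m₁ * P) = R * t₁ / 2 := by rw [hR, ht₁]; ring
    rw [this]; linarith
  -- `cL ≤ cL^*`
  have hcLs_le : cL ≤ cLs := by
    rw [hcL, hcLs]
    refine mul_le_mul_of_nonneg_left (Real.exp_le_exp.2 ?_) (by positivity)
    -- the exponent: `18k²(q/n²)t₁/(π²loA) ≤ 18k²(q/n²)(2/R)/(π²loA) = 9k²/(2π⁴(lo/Λ)²(ν²+c)) ≤ E₁`
    have h1 : 18 * (k : ℝ) ^ 2 * (q / (n : ℝ) ^ 2) * (m₁ * P) / (Real.pi ^ 2 * (ν * (lo / Λ)))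
        ≤ 18 * (k : ℝ) ^ 2 * (q / (n : ℝ) ^ 2) * (2 / R) / (Real.pi ^ 2 * (ν * (lo / Λ))) := by
      refine div_le_div_of_nonneg_right (mul_le_mul_of_nonneg_left ?_ (by positivity)) (by positivity)
      rw [← ht₁]; exact ht₁hi
    refine h1.trans ?_
    have e2 : 18 * (k : ℝ) ^ 2 * (q / (n : ℝ) ^ 2) * (2 / R) / (Real.pi ^ 2 * (ν * (lo / Λ)))
        = 9 * (k : ℝ) ^ 2 / (2 * Real.pi ^ 4 * (lo / Λ) ^ 2 * (ν ^ 2 + c)) := by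
      rw [hR]; unfold loT
      have hνc : ν ^ 2 + c ≠ 0 := by have := hν.1; positivity
      field_simp
      ring
    rw [e2, hE₁]
    refine div_le_div_of_nonneg_left (by positivity) (by positivity) ?_
    refine mul_le_mul_of_nonneg_left ?_ (by positivity)
    nlinarith [hν.1]
  -- `κ ≤ κ^*`
  have hκs_le : κ ≤ κs := by
    rw [hκ, hκs]; refine Real.exp_le_exp.2 (neg_le_neg (mul_le_mul_of_nonneg_left ?_ (by positivity)))
    rw [← ht₁]; exact ht₁lo
  -- `ρ ≤ 3/4`
  have hρ34 : θ + cV + cL + 3 * cS + κ ≤ 3 / 4 := by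
    have : Real.exp (-(1 / 2 : ℝ)) + cV + cLs + 3 * cS + κs ≤ 3 / 4 := hρ
    linarith
  have hρ0 : 0 ≤ θ + cV + cL + 3 * cS + κ := by positivity
  have hρ1 : θ + cV + cL + 3 * cS + κ ≤ 1 := by linarith
  -- `θ ≥ 1/3` (from `R t₁ ≤ 2`) hence `cS ≤ 5/36`
  have hθlo : (1:ℝ) / 3 ≤ θ := by
    have h1 : Real.exp (-1) ≤ θ := by
      rw [hθ]; refine Real.exp_le_exp.2 ?_
      have : 4 * Real.pi ^ 2 * loT lo Λ c ν n * q * (m₁ * P) = R * t₁ / 2 := by rw [hR, ht₁]; ring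
      rw [this]
      have := mul_le_mul_of_nonneg_left ht₁hi hR0.le
      have e2 : R * (2 / R) = 2 := by field_simp
      linarith
    have h2 : (1:ℝ) / 3 ≤ Real.exp (-1) := by
      rw [Real.exp_neg, inv_eq_one_div, div_le_div_iff₀ (by norm_num) (Real.exp_pos 1)]
      have := Real.exp_one_lt_d9; norm_num at this ⊢; linarith
    linarith
  have hcS536 : cS ≤ 5 / 36 := by linarith [hρ34, hθlo, hcV0, hcL0, hκ0']
  -- ### the instantiated sideband iteration
  have hiter := sideband_le_iterate_fast hV hlo hhi hΛ hc.le hC hν hn hodd hwin hΦw hU hT hsT j₀ hs₀ m₁ hm₁1 hLb hℓ0 hℓL hscale v hv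
    hvcl hv1 hv2 hθ hcV hcL hcS hκ hθlo hcS536
  set j : ℕ := ⌊(t - s) / t₁⌋₊ with hj
  have hjle : (j : ℝ) ≤ (t - s) / t₁ := Nat.floor_le (by positivity)
  have hjlt : (t - s) / t₁ < j + 1 := Nat.lt_floor_add_one _
  have hj1 : 1 ≤ j := Nat.le_floor (by rw [Nat.cast_one, le_div_iff₀ ht₁0, one_mul]; exact ht₁τ)
  have hlow : s + j * (m₁ * (M * W.period / ν)) ≤ t := by
    rw [← hP, ← ht₁]; have := (le_div_iff₀ ht₁0).1 hjle; linarith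
  have hupp : t ≤ s + (j + 1) * (m₁ * (M * W.period / ν)) := by
    rw [← hP, ← ht₁]; have := (div_lt_iff₀ ht₁0).1 hjlt; linarith
  have hmain := hiter j t hlow hupp htT
  -- ### the window factor: `ρ^j ≤ 265·(m₁ y)²`
  set ρ : ℝ := θ + cV + cL + 3 * cS + κ with hρdef
  set y : ℝ := P / (t - s) with hy
  have hy0 : 0 < y := div_pos hP0 hτ0
  have hWf : ((j : ℝ) + 1) ^ 2 * ρ ^ (j - 1) ≤ 265 := window_factor_le hρ0 hρ34 hj1
  have hmy1 : 1 ≤ ((j : ℝ) + 1) * (m₁ * y) := by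
    have h1 : t - s ≤ (j + 1) * t₁ := by have := (div_lt_iff₀ ht₁0).1 hjlt; linarith
    have h2 : ((j : ℝ) + 1) * (m₁ * y) = (j + 1) * t₁ / (t - s) := by rw [hy, ht₁]; field_simp
    rw [h2, le_div_iff₀ hτ0, one_mul]; exact h1
  have hρj1 : ρ ^ (j - 1) ≤ 265 * (m₁ * y) ^ 2 := by
    have hp0 : 0 ≤ ρ ^ (j - 1) := pow_nonneg hρ0 _
    have h3 : 1 ≤ (((j : ℝ) + 1) * (m₁ * y)) ^ 2 := one_le_pow₀ hmy1
    calc ρ ^ (j - 1) ≤ ρ ^ (j - 1) * (((j : ℝ) + 1) * (m₁ * y)) ^ 2 := le_mul_of_one_le_right hp0 h3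
      _ = (((j : ℝ) + 1) ^ 2 * ρ ^ (j - 1)) * (m₁ * y) ^ 2 := by ring
      _ ≤ 265 * (m₁ * y) ^ 2 := mul_le_mul_of_nonneg_right hWf (sq_nonneg _)
  have hρj : ρ ^ j ≤ 265 * (m₁ * y) ^ 2 := (pow_le_pow_of_le_one hρ0 hρ1 (Nat.sub_le j 1)).trans hρj1
  -- `(cS+κ)^j ≤ (cS+κ)·265(m₁y)²`
  have hcκ0 : 0 ≤ cS + κ := add_nonneg hcS0 hκ0'
  have hcκρ : cS + κ ≤ ρ := by rw [hρdef]; linarith [hθ0, hcV0, hcL0, hcS0]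
  have hcκj : (cS + κ) ^ j ≤ (cS + κ) * (265 * (m₁ * y) ^ 2) := by
    have e1 : (cS + κ) ^ j = (cS + κ) * (cS + κ) ^ (j - 1) := by
      rw [← pow_succ']; congr 1; omega
    rw [e1]
    exact mul_le_mul_of_nonneg_left ((pow_le_pow_left₀ hcκ0 hcκρ _).trans hρj1) hcκ0
  -- ### `cS ≤ cSp·√u`, `m₁ y ≤ 2y/u`, `2y ≤ u`
  set S : ℝ := ∑ j, ‖slotAmp W j‖ with hSdef
  have hS0 : 0 ≤ S := Finset.sum_nonneg fun j _ => norm_nonneg _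
  set cSp : ℝ := 8 * S / (Real.pi * (lo / Λ) * Real.sqrt (8 * Real.pi ^ 2 * (lo / Λ) * (M * W.period) * c)) with hcSp
  have hcSp0 : 0 ≤ cSp := by rw [hcSp]; positivity
  have hcSu : cS ≤ cSp * Real.sqrt u := by
    have h := cS_le_cSp_sqrt (W := W) hlo hΛ hc hM hν.1 hn S hS0 ℓ
    rw [hcS, hcSp, hSdef, hu, hR, hq, hP]
    exact h
  have hyu : 2 * y ≤ u := by
    have e1 : u = R * (t - s) * y := by rw [hu, hy]; field_simp
    rw [e1]; nlinarith [mul_nonneg (sub_nonneg.2 hRτ) hy0.le]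
  have hmy : (m₁ : ℝ) * y ≤ 2 * y / u := by
    have := mul_le_mul_of_nonneg_right hm₁2 hy0.le
    calc (m₁ : ℝ) * y ≤ 2 / u * y := this
      _ = 2 * y / u := by ring
  -- ### the scalar charge `√u·(2y/u)² ≤ √2·√y`
  have hcharge : Real.sqrt u * (2 * y / u) ^ 2 ≤ Real.sqrt 2 * Real.sqrt y := by
    set z : ℝ := y / u with hz
    have hz0 : 0 ≤ z := by rw [hz]; positivity
    have hz2 : z ≤ 1 / 2 := by rw [hz, div_le_iff₀ hu0]; linarith
    have e1 : (2 * y / u) = 2 * z := by rw [hz]; ring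
    have e2 : Real.sqrt y = Real.sqrt z * Real.sqrt u := by
      rw [← Real.sqrt_mul hz0, hz, div_mul_cancel₀ _ hune]
    rw [e1, e2]
    have hsu0 : 0 ≤ Real.sqrt u := Real.sqrt_nonneg _
    -- `4z² ≤ √2·√z`
    have h4 : (2 * z) ^ 2 ≤ Real.sqrt 2 * Real.sqrt z := by
      have hl : 0 ≤ (2 * z) ^ 2 := sq_nonneg _
      have hr : 0 ≤ Real.sqrt 2 * Real.sqrt z := by positivity
      have hsq : ((2 * z) ^ 2) ^ 2 ≤ (Real.sqrt 2 * Real.sqrt z) ^ 2 := by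
        rw [mul_pow (Real.sqrt 2) (Real.sqrt z) 2, Real.sq_sqrt (by norm_num : (0:ℝ) ≤ 2), Real.sq_sqrt hz0]
        have h3 : z * z ^ 3 ≤ z * (1 / 2) ^ 3 := mul_le_mul_of_nonneg_left (pow_le_pow_left₀ hz0 hz2 3) hz0
        nlinarith [h3, sq_nonneg z]
      exact (pow_le_pow_iff_left₀ hl hr two_ne_zero).1 hsq
    calc Real.sqrt u * (2 * z) ^ 2 = (2 * z) ^ 2 * Real.sqrt u := by ring
      _ ≤ (Real.sqrt 2 * Real.sqrt z) * Real.sqrt u := mul_le_mul_of_nonneg_right h4 hsu0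
      _ = Real.sqrt 2 * (Real.sqrt z * Real.sqrt u) := by ring
  -- ### the kill: `κ ≤ exp(−a₁/u) ≤ 2u²/a₁²`, so `κ·(2y/u)² ≤ 8y²/a₁² ≤ 8y^e/a₁²`
  set a₁ : ℝ := Real.pi ^ 2 * (lo / Λ) * (M * W.period) / 2 with ha₁
  have ha₁0 : 0 < a₁ := by rw [ha₁]; positivity
  have hy1 : y ≤ 1 := by linarith [hyu, hu1]
  have hye : Real.sqrt y ≤ y ^ e := by rw [Real.sqrt_eq_rpow]; exact Real.rpow_le_rpow_of_exponent_ge hy0 hy1 he12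
  have hye0 : 0 ≤ y ^ e := Real.rpow_nonneg hy0.le e
  have hy2e : y ^ 2 ≤ y ^ e := by
    rw [show y ^ 2 = y ^ (2:ℝ) by norm_cast]
    exact Real.rpow_le_rpow_of_exponent_ge hy0 hy1 (by linarith)
  have hκu : κ ≤ Real.exp (-(a₁ / u)) := by
    refine hκs_le.trans (Real.exp_le_exp.2 (neg_le_neg (le_of_eq ?_)))
    rw [ha₁, hu, hP]; field_simp
  have hexp : Real.exp (-(a₁ / u)) ≤ 2 * u ^ 2 / a₁ ^ 2 := by
    have hau : 0 < a₁ / u := div_pos ha₁0 hu0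
    have h1 := Real.quadratic_le_exp_of_nonneg hau.le
    have h2 : (a₁ / u) ^ 2 / 2 ≤ Real.exp (a₁ / u) := by linarith only [h1, hau.le]
    have e3 : 2 * u ^ 2 / a₁ ^ 2 = 1 / ((a₁ / u) ^ 2 / 2) := by field_simp
    rw [Real.exp_neg, e3, inv_eq_one_div]
    exact one_div_le_one_div_of_le (by positivity) h2
  set B : ℝ := 4240 / a₁ ^ 2 with hB
  have hκcharge : 530 * (κ * (2 * y / u) ^ 2) ≤ B * y ^ e := by
    have h1 : κ * (2 * y / u) ^ 2 ≤ (2 * u ^ 2 / a₁ ^ 2) * (2 * y / u) ^ 2 :=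
      mul_le_mul_of_nonneg_right (hκu.trans hexp) (sq_nonneg _)
    have e2 : (2 * u ^ 2 / a₁ ^ 2) * (2 * y / u) ^ 2 = (8 / a₁ ^ 2) * y ^ 2 := by
      field_simp
      ring
    rw [e2] at h1
    have h3 : (8 / a₁ ^ 2) * y ^ 2 ≤ (8 / a₁ ^ 2) * y ^ e := mul_le_mul_of_nonneg_left hy2e (by positivity)
    have e4 : 530 * ((8 / a₁ ^ 2) * y ^ e) = B * y ^ e := by rw [hB]; ring
    rw [← e4]
    exact mul_le_mul_of_nonneg_left (h1.trans h3) (by norm_num)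
  -- ### assembling the coefficient: `2(cS+κ)^j + 21·cS·ρ^j ≤ (8750·cSp + 4240/a₁²)·y^e`
  have hs2 : Real.sqrt 2 ≤ 283 / 200 := by rw [Real.sqrt_le_left (by norm_num)]; norm_num
  have hm2 : (m₁ * y) ^ 2 ≤ (2 * y / u) ^ 2 := pow_le_pow_left₀ (by positivity) hmy 2
  -- `cS·(2y/u)² ≤ cSp·√2·y^e`
  have hcScharge : cS * (2 * y / u) ^ 2 ≤ cSp * (Real.sqrt 2 * y ^ e) := by
    have h1 : cS * (2 * y / u) ^ 2 ≤ (cSp * Real.sqrt u) * (2 * y / u) ^ 2 := mul_le_mul_of_nonneg_right hcSu (sq_nonneg _)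
    have h2 : (cSp * Real.sqrt u) * (2 * y / u) ^ 2 = cSp * (Real.sqrt u * (2 * y / u) ^ 2) := by ring
    have h3 : cSp * (Real.sqrt u * (2 * y / u) ^ 2) ≤ cSp * (Real.sqrt 2 * Real.sqrt y) := mul_le_mul_of_nonneg_left hcharge hcSp0
    have h4 : cSp * (Real.sqrt 2 * Real.sqrt y) ≤ cSp * (Real.sqrt 2 * y ^ e) :=
      mul_le_mul_of_nonneg_left (mul_le_mul_of_nonneg_left hye (Real.sqrt_nonneg _)) hcSp0
    exact (h1.trans_eq h2).trans (h3.trans h4)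
  have hcoef : 2 * (cS + κ) ^ j + 21 * cS * ρ ^ j ≤ (8750 * cSp + B) * y ^ e := by
    -- first summand
    have h1a : (cS + κ) * (265 * (m₁ * y) ^ 2) ≤ (cS + κ) * (265 * (2 * y / u) ^ 2) :=
      mul_le_mul_of_nonneg_left (mul_le_mul_of_nonneg_left hm2 (by norm_num)) hcκ0
    have h1b := hcκj.trans h1a
    have e1 : (cS + κ) * (265 * (2 * y / u) ^ 2) = 265 * (cS * (2 * y / u) ^ 2) + 265 * (κ * (2 * y / u) ^ 2) := by ring
    have h1 : 2 * (cS + κ) ^ j ≤ 530 * (cS * (2 * y / u) ^ 2) + 530 * (κ * (2 * y / u) ^ 2) := by linarith only [h1b, e1]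
    -- second summand
    have h2a : ρ ^ j ≤ 265 * (2 * y / u) ^ 2 := hρj.trans (mul_le_mul_of_nonneg_left hm2 (by norm_num))
    have h2b := mul_le_mul_of_nonneg_left h2a (mul_nonneg (by norm_num : (0:ℝ) ≤ 21) hcS0)
    have e2 : 21 * cS * (265 * (2 * y / u) ^ 2) = 5565 * (cS * (2 * y / u) ^ 2) := by ring
    have h2 : 21 * cS * ρ ^ j ≤ 5565 * (cS * (2 * y / u) ^ 2) := by linarith only [h2b, e2]
    -- the `cS`-charge and the `κ`-charge
    have h3 : 6095 * (cS * (2 * y / u) ^ 2) ≤ 6095 * (cSp * (Real.sqrt 2 * y ^ e)) := mul_le_mul_of_nonneg_left hcScharge (by norm_num)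
    have h5a : cSp * (Real.sqrt 2 * y ^ e) ≤ cSp * ((283 / 200) * y ^ e) :=
      mul_le_mul_of_nonneg_left (mul_le_mul_of_nonneg_right hs2 hye0) hcSp0
    have h5b : 0 ≤ cSp * y ^ e := mul_nonneg hcSp0 hye0
    have e5 : cSp * ((283 / 200) * y ^ e) = (283 / 200) * (cSp * y ^ e) := by ring
    have e6 : (8750 * cSp + B) * y ^ e = 8750 * (cSp * y ^ e) + B * y ^ e := by ring
    linarith only [h1, h2, h3, hκcharge, h5a, h5b, e5, e6]
  -- ### the currency: `alw ≥ C₁ y^e`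
  have hy1' : M * W.period / ν / (t - s) ≤ 1 := hy1
  have hmin_y : min 1 (M * W.period / ν / (t - s)) = y := min_eq_right hy1'
  have hue : 0 ≤ ((⌈K / ν⌉₊ : ℝ) / n) ^ e := Real.rpow_nonneg (by positivity) e
  have hνe0 : 0 ≤ ν ^ e := Real.rpow_nonneg hν.1.le e
  have halw : C₁ * y ^ e ≤ C₁ * (C₁ * (ν ^ e + ((⌈K / ν⌉₊ : ℝ) / n) ^ e) + y ^ e) := by
    nlinarith [mul_nonneg hC₁0 (mul_nonneg hC₁0 (add_nonneg hνe0 hue))]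
  have hthr : (8750 * cSp + B) * y ^ e ≤ C₁ * y ^ e := mul_le_mul_of_nonneg_right hC₁s hye0
  rw [hmin_y]
  calc Real.sqrt (‖U s t v‖ ^ 2 - (‖fc (U s t v) ℓ‖ ^ 2 + ‖fc (U s t v) (-ℓ)‖ ^ 2))
      ≤ (2 * (cS + κ) ^ j + 21 * cS * ρ ^ j) * ‖v‖ := hmain
    _ ≤ ((8750 * cSp + B) * y ^ e) * ‖v‖ := mul_le_mul_of_nonneg_right hcoef (norm_nonneg _)
    _ ≤ (C₁ * y ^ e) * ‖v‖ := mul_le_mul_of_nonneg_right hthr (norm_nonneg _)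
    _ ≤ (C₁ * (C₁ * (ν ^ e + ((⌈K / ν⌉₊ : ℝ) / n) ^ e) + y ^ e)) * ‖v‖ := mul_le_mul_of_nonneg_right halw (norm_nonneg _)

end Clause

end Summit.AnomalousDissipation.AnomalousDissipation.Theorems.SolenoidalFractalHomogenisation.LagrangianStep.VmodGen

end
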